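import Mathlib
import HarnessLib

/-!
# Route `LeeYangFibres`, crux `RelativeDimOne` (stmt-Parity-14113): vocabulary of the RESHAPED
# pair-slice rigidity (seat c1) — route-posited objects, nothing asserted

The registered stub `stub_rigidity : IncidenceRigidity (1/4) (3/10)` of line `gallagher-backwards-split`
is false (crux workfile `Cruxes/RelativeDimOne/StubRigidityFalse-c1.md`); the reshape proved in
`…PairRigidityDecay{Tools,Main,}.lean` is stated in elementary divisor language, whose objects are:

* `phiDivSum n = Σ_{d ∣ n} 1/φ(d)` — the scale `G(n) ≍ n/φ(n)` (for squarefree `n`, `= Π_{p∣n} p/(p−1)`);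
* `divSum x h = Σ_{d ∣ h} x_d` — the divisor sum `F(h)` of a spectrum `x : ℕ → ℝ` (the pair/translate
  slice of an incidence-bandlimited function: `E(b) = F(b₂ − b₁)`);
* `densAvg Q x q r = Σ_{1≤d≤Q} x_d · (gcd(d,q)/d) · [gcd(d,q) ∣ r]` — the DENSITY AVERAGE `Φ_q(r)` of `F`
  over `h ≡ r (mod q)` (what the box-coset data of `IncidenceRigidity` reduce to, up to `o(1)`);
* `rphiDivSum n = Σ_{d ∣ n} 1/(dφ(d))` and `roughPrimorial w M = Π_{w < p ≤ M} p` — tools for the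
  `w`-rough tail.
-/

noncomputable section

open scoped BigOperators
open Finset Real

namespace Summit.Parity.GeneralizedHardyLittlewood.Cruxes.RelativeDimOne.RigidityC1

/-- The scale `G(n) = Σ_{d ∣ n} 1/φ(d)` (for squarefree `n` this is `Π_{p ∣ n} p/(p−1) = n/φ(n)`). -/
def phiDivSum (n : ℕ) : ℝ := ∑ d ∈ n.divisors, (1 : ℝ) / (Nat.totient d)

/-- The divisor sum `F(h) = Σ_{d ∣ h} x_d` of a spectrum `x`. -/
def divSum (x : ℕ → ℝ) (h : ℕ) : ℝ := ∑ d ∈ h.divisors, x d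

/-- The density average of `F` over `h ≡ r (mod q)` for a level-`Q` spectrum:
`Φ_q(r) = Σ_{1 ≤ d ≤ Q} x_d · (gcd(d,q)/d) · [gcd(d,q) ∣ r]`. -/
def densAvg (Q : ℕ) (x : ℕ → ℝ) (q r : ℕ) : ℝ :=
  ∑ d ∈ Icc 1 Q, x d * ((Nat.gcd d q : ℝ) / d) * (if Nat.gcd d q ∣ r then 1 else 0)

/-- `R(n) = Σ_{d ∣ n} 1/(d φ(d))`. -/
def rphiDivSum (n : ℕ) : ℝ := ∑ d ∈ n.divisors, (1 : ℝ) / ((d : ℝ) * Nat.totient d)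

/-- The product of the primes in `(w, M]`. -/
def roughPrimorial (w M : ℕ) : ℕ := ∏ p ∈ (Ioc w M).filter Nat.Prime, p

/-- `G(1) = 1` (sanity / hook). -/
theorem phiDivSum_one : phiDivSum 1 = 1 := by
  simp [phiDivSum]

end Summit.Parity.GeneralizedHardyLittlewood.Cruxes.RelativeDimOne.RigidityC1
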